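import Mathlib.Algebra.BigOperators.Fin
import Summits.ValiantsHypothesis.ValiantsHypothesis.Theorems.KPlusLogSqLawTropicalBMarkedEdgeExchange

/-!
# Route «KPlusLogSqLaw», crux `TropicalB` (stmt-ValiantsHypothesis-19771) — MARKED-EDGE sector: HALL COMPLETION OF A COVER INSIDE FOUR COVERS

HONEST FRAMING.  Helper file (cell `pub-symmetroid`, seat val-sym-trop-p4 (g18), 2026-08-28; `--supports stmt-ValiantsHypothesis-19771 --as
helper`).  Pure combinatorics, no design vocabulary: the four-cover analogue of `FourBit.two_factor` (g16, `…MarkedEdgeExchange`), needed to run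
g17's four-factor rigidity `FourBit.four_factors_eq` (`…MarkedEdgeExchangeFour`) on an ARBITRARY cover inside the arcs of four covers (part 6 of
this seat's all-`m` structure of the nested-triangle core uses it for the four-body Z-rigidity / height order).  Nothing here concerns
`TropicalB`, `WeakLifting`, the doors, `MatrixDescartes` (stmt-ValiantsHypothesis-18050) or VP ≠ VNP.

CONTENTS (all `[folklore]`: König's theorem that a regular bipartite multigraph factors into perfect matchings, in the pointwise bookkeeping of
the four-bit chain):
* `hall_three` — three target maps `a, b, c : V → V` hitting every node exactly three times in total admit a bijective selection
  `f i ∈ {a i, b i, c i}` (Hall's theorem with fibres of size ≤ 3);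
* `split_two` — two target maps hitting every node exactly twice split into two bijections (the second half of `two_factor`, restated for
  bare maps);
* `three_factor` — every cover `R` inside the arcs of `σ₁, σ₂, σ₃, σ₄` extends to a factorisation `(R, M₂, M₃, M₄)` of `σ₁ ⊎ σ₂ ⊎ σ₃ ⊎ σ₄`,
  recorded pointwise as `List.Perm [R i, M₂ i, M₃ i, M₄ i] [σ₁ i, σ₂ i, σ₃ i, σ₄ i]`.
-/

set_option linter.dupNamespace false
set_option autoImplicit false

namespace Summit.ValiantsHypothesis.ValiantsHypothesis.Theorems.KPlusLogSqLaw
namespace MarkedEdge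
namespace Core

open Finset

variable {V : Type*} [Fintype V] [DecidableEq V]

/-- Indicator sum of a bijection hitting a point: exactly one preimage. [folklore] -/
theorem sum_ite_eq_one_of_bijective {f : V → V} (hf : Function.Bijective f) (j : V) :
    (∑ i, if f i = j then (1 : ℕ) else 0) = 1 := by
  obtain ⟨i₀, hi₀⟩ := hf.2 j
  rw [Finset.sum_eq_single i₀]
  · simp [hi₀]
  · intro i _ hi; rw [if_neg]; intro h; exact hi (hf.1 (h.trans hi₀.symm))
  · simp

/-- **Hall selection from a 3-regular target system.**  If the maps `a, b, c : V → V` hit every node exactly three times in total, there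
is a bijection `f` with `f i ∈ {a i, b i, c i}` for all `i`. [folklore: Hall's theorem for regular bipartite multigraphs] -/
theorem hall_three (a b c : V → V)
    (hcol : ∀ j, (∑ i, if a i = j then (1 : ℕ) else 0) + (∑ i, if b i = j then (1 : ℕ) else 0) +
      (∑ i, if c i = j then (1 : ℕ) else 0) = 3) :
    ∃ f : V → V, Function.Bijective f ∧ ∀ i, f i = a i ∨ f i = b i ∨ f i = c i := by
  classical
  have hHall : ∀ s : Finset V, s.card ≤ (s.biUnion fun i => ({a i, b i, c i} : Finset V)).card := by
    intro s
    let f : V × Fin 3 → V := fun p => if p.2 = 0 then a p.1 else if p.2 = 1 then b p.1 else c p.1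
    have Hf : ∀ p ∈ s ×ˢ (Finset.univ : Finset (Fin 3)), f p ∈ s.biUnion fun i => ({a i, b i, c i} : Finset V) := by
      rintro ⟨i, e⟩ hp
      rw [Finset.mem_product] at hp
      rw [Finset.mem_biUnion]
      refine ⟨i, hp.1, ?_⟩
      fin_cases e <;> simp [f]
    have hfib : ∀ j ∈ s.biUnion (fun i => ({a i, b i, c i} : Finset V)),
        ((s ×ˢ (Finset.univ : Finset (Fin 3))).filter fun p => f p = j).card ≤ 3 := by
      intro j _
      calc ((s ×ˢ (Finset.univ : Finset (Fin 3))).filter fun p => f p = j).card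
          ≤ ((Finset.univ : Finset (V × Fin 3)).filter fun p => f p = j).card :=
            Finset.card_le_card (Finset.filter_subset_filter _ (Finset.subset_univ _))
        _ = ∑ p : V × Fin 3, if f p = j then 1 else 0 := Finset.card_filter _ _
        _ = ∑ i : V, ((if a i = j then 1 else 0) + (if b i = j then 1 else 0) + (if c i = j then 1 else 0)) := by
            rw [Fintype.sum_prod_type]
            refine Finset.sum_congr rfl fun i _ => ?_
            rw [Fin.sum_univ_three]; simp [f]
        _ = 3 := by rw [Finset.sum_add_distrib, Finset.sum_add_distrib]; exact hcol j
    have h := Finset.card_le_mul_card_image_of_maps_to Hf 3 hfib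
    rw [Finset.card_product, Finset.card_univ, Fintype.card_fin] at h
    omega
  obtain ⟨f, hfinj, hfmem⟩ := (Finset.all_card_le_biUnion_card_iff_exists_injective _).mp hHall
  refine ⟨f, Finite.injective_iff_bijective.mp hfinj, fun i => ?_⟩
  simpa using hfmem i

/-- **Splitting a 2-regular target system.**  If the maps `p, q : V → V` hit every node exactly twice in total, there are bijections
`f, g` with `{f i, g i} = {p i, q i}` at every node. [folklore: König; cf. `FourBit.two_factor`] -/
theorem split_two (p q : V → V)
    (hcol : ∀ j, (∑ i, if p i = j then (1 : ℕ) else 0) + (∑ i, if q i = j then (1 : ℕ) else 0) = 2) :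
    ∃ f g : V → V, Function.Bijective f ∧ Function.Bijective g ∧ ∀ i, (f i = p i ∧ g i = q i) ∨ (f i = q i ∧ g i = p i) := by
  classical
  have hHall : ∀ s : Finset V, s.card ≤ (s.biUnion fun i => ({p i, q i} : Finset V)).card := by
    intro s
    let f : V × Bool → V := fun r => if r.2 then p r.1 else q r.1
    have Hf : ∀ r ∈ s ×ˢ (Finset.univ : Finset Bool), f r ∈ s.biUnion fun i => ({p i, q i} : Finset V) := by
      rintro ⟨i, e⟩ hr
      rw [Finset.mem_product] at hr
      rw [Finset.mem_biUnion]
      refine ⟨i, hr.1, ?_⟩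
      cases e <;> simp [f]
    have hfib : ∀ j ∈ s.biUnion (fun i => ({p i, q i} : Finset V)),
        ((s ×ˢ (Finset.univ : Finset Bool)).filter fun r => f r = j).card ≤ 2 := by
      intro j _
      calc ((s ×ˢ (Finset.univ : Finset Bool)).filter fun r => f r = j).card
          ≤ ((Finset.univ : Finset (V × Bool)).filter fun r => f r = j).card :=
            Finset.card_le_card (Finset.filter_subset_filter _ (Finset.subset_univ _))
        _ = ∑ r : V × Bool, if f r = j then 1 else 0 := Finset.card_filter _ _
        _ = ∑ i : V, ((if p i = j then 1 else 0) + (if q i = j then 1 else 0)) := by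
            rw [Fintype.sum_prod_type]
            refine Finset.sum_congr rfl fun i _ => ?_
            rw [Fintype.sum_bool]; simp [f]
        _ = 2 := by rw [Finset.sum_add_distrib]; exact hcol j
    have h := Finset.card_le_mul_card_image_of_maps_to Hf 2 hfib
    rw [Finset.card_product, Finset.card_univ, Fintype.card_bool] at h
    omega
  obtain ⟨f, hfinj, hfmem⟩ := (Finset.all_card_le_biUnion_card_iff_exists_injective _).mp hHall
  have hf : ∀ i, f i = p i ∨ f i = q i := fun i => by simpa using hfmem i
  have hfbij : Function.Bijective f := Finite.injective_iff_bijective.mp hfinj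
  let g : V → V := fun i => if f i = p i then q i else p i
  have hfg : ∀ i, (f i = p i ∧ g i = q i) ∨ (f i = q i ∧ g i = p i) := by
    intro i
    by_cases h : f i = p i
    · exact Or.inl ⟨h, by simp only [g, if_pos h]⟩
    · exact Or.inr ⟨(hf i).resolve_left h, by simp only [g, if_neg h]⟩
  have hind_f : ∀ i j, f i = j → 1 ≤ (if p i = j then (1 : ℕ) else 0) + (if q i = j then 1 else 0) := by
    intro i j h
    rcases hf i with h' | h'
    · rw [if_pos (h'.symm.trans h)]; omega
    · rw [if_pos (h'.symm.trans h : q i = j)]; omega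
  have hind_g : ∀ i j, g i = j → 1 ≤ (if p i = j then (1 : ℕ) else 0) + (if q i = j then 1 else 0) := by
    intro i j h
    rcases hfg i with ⟨-, h'⟩ | ⟨-, h'⟩
    · rw [if_pos (h'.symm.trans h : q i = j)]; omega
    · rw [if_pos (h'.symm.trans h : p i = j)]; omega
  have hind_both : ∀ i j, f i = j → g i = j → (if p i = j then (1 : ℕ) else 0) + (if q i = j then 1 else 0) = 2 := by
    intro i j hfj hgj
    rcases hfg i with ⟨h1, h2⟩ | ⟨h1, h2⟩
    · rw [if_pos (h1.symm.trans hfj), if_pos (h2.symm.trans hgj)]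
    · rw [if_pos (h2.symm.trans hgj), if_pos (h1.symm.trans hfj)]
  have hle2 : ∀ (j : V) (s : Finset V),
      (∑ i ∈ s, ((if p i = j then (1 : ℕ) else 0) + (if q i = j then 1 else 0))) ≤ 2 := by
    intro j s
    calc (∑ i ∈ s, ((if p i = j then (1 : ℕ) else 0) + (if q i = j then 1 else 0)))
        ≤ ∑ i, ((if p i = j then (1 : ℕ) else 0) + (if q i = j then 1 else 0)) :=
          Finset.sum_le_sum_of_subset_of_nonneg (Finset.subset_univ s) fun _ _ _ => Nat.zero_le _
      _ = 2 := by rw [Finset.sum_add_distrib]; exact hcol j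
  have hginj : Function.Injective g := by
    intro i i' hii'
    by_contra hne
    set j := g i with hj
    obtain ⟨i'', hi''⟩ := hfbij.2 j
    have hc1 := hind_g i j rfl
    have hc2 := hind_g i' j hii'.symm
    by_cases h1 : i'' = i
    · subst h1
      have h2 := hind_both _ j hi'' rfl
      have := hle2 j {i'', i'}
      rw [Finset.sum_pair hne] at this
      omega
    by_cases h2 : i'' = i'
    · subst h2
      have h3 := hind_both _ j hi'' hii'.symm
      have := hle2 j {i, i''}
      rw [Finset.sum_pair hne] at this
      omega
    · have h3 := hind_f i'' j hi''
      have := hle2 j {i, i', i''}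
      rw [Finset.sum_insert (by simp [hne, Ne.symm h1]), Finset.sum_pair (Ne.symm h2)] at this
      omega
  exact ⟨f, g, hfbij, Finite.injective_iff_bijective.mp hginj, hfg⟩

omit [Fintype V] in
/-- removing one occurrence: if `r ∈ [x₁, x₂, x₃, x₄]` then for the «first match» remainder `(a, b, c)` one has
`[r, a, b, c] ~ [x₁, x₂, x₃, x₄]`. [folklore] -/
theorem perm_remove_four (r x₁ x₂ x₃ x₄ : V) (hr : r = x₁ ∨ r = x₂ ∨ r = x₃ ∨ r = x₄) :
    List.Perm [r, (if r = x₁ then x₂ else x₁), (if r = x₁ then x₃ else if r = x₂ then x₃ else x₂),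
      (if r = x₁ then x₄ else if r = x₂ then x₄ else if r = x₃ then x₄ else x₃)] [x₁, x₂, x₃, x₄] := by
  by_cases h1 : r = x₁
  · subst h1; simp
  · by_cases h2 : r = x₂
    · subst h2; simp only [if_neg h1, if_true]
      exact List.Perm.swap x₁ r [x₃, x₄]
    · by_cases h3 : r = x₃
      · subst h3; simp only [if_neg h1, if_neg h2, if_true]
        exact ((List.Perm.swap x₁ r [x₂, x₄]).trans (List.Perm.cons x₁ (List.Perm.swap x₂ r [x₄])))
      · have h4 : r = x₄ := by rcases hr with h | h | h | h; exacts [absurd h h1, absurd h h2, absurd h h3, h]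
        subst h4; simp only [if_neg h1, if_neg h2, if_neg h3]
        exact ((List.Perm.swap x₁ r [x₂, x₃]).trans
          (List.Perm.cons x₁ ((List.Perm.swap x₂ r [x₃]).trans (List.Perm.cons x₂ (List.Perm.swap x₃ r [])))))

omit [Fintype V] in
/-- removing one occurrence from three. [folklore] -/
theorem perm_remove_three (r y₁ y₂ y₃ : V) (hr : r = y₁ ∨ r = y₂ ∨ r = y₃) :
    List.Perm [r, (if r = y₁ then y₂ else y₁), (if r = y₁ then y₃ else if r = y₂ then y₃ else y₂)] [y₁, y₂, y₃] := by
  by_cases h1 : r = y₁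
  · subst h1; simp
  · by_cases h2 : r = y₂
    · subst h2; simp only [if_neg h1, if_true]
      exact List.Perm.swap y₁ r [y₃]
    · have h3 : r = y₃ := by rcases hr with h | h | h; exacts [absurd h h1, absurd h h2, h]
      subst h3; simp only [if_neg h1, if_neg h2]
      exact (List.Perm.swap y₁ r [y₂]).trans (List.Perm.cons y₁ (List.Perm.swap y₂ r []))

/-- **THREE-FACTOR COMPLETION (König / Hall).**  Every cover `R` whose arcs are arcs of `σ₁, σ₂, σ₃` or `σ₄` extends to a factorisation
`(R, M₂, M₃, M₄)` of the arc multiset `σ₁ ⊎ σ₂ ⊎ σ₃ ⊎ σ₄`. [folklore; four-cover analogue of `FourBit.two_factor`] -/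
theorem three_factor (σ₁ σ₂ σ₃ σ₄ R : Equiv.Perm V) (hR : ∀ i, R i = σ₁ i ∨ R i = σ₂ i ∨ R i = σ₃ i ∨ R i = σ₄ i) :
    ∃ M₂ M₃ M₄ : Equiv.Perm V, ∀ i, List.Perm [R i, M₂ i, M₃ i, M₄ i] [σ₁ i, σ₂ i, σ₃ i, σ₄ i] := by
  classical
  -- the three remaining targets at each node
  let a : V → V := fun i => if R i = σ₁ i then σ₂ i else σ₁ i
  let b : V → V := fun i => if R i = σ₁ i then σ₃ i else if R i = σ₂ i then σ₃ i else σ₂ i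
  let c : V → V := fun i => if R i = σ₁ i then σ₄ i else if R i = σ₂ i then σ₄ i else if R i = σ₃ i then σ₄ i else σ₃ i
  have hPabc : ∀ i, List.Perm [R i, a i, b i, c i] [σ₁ i, σ₂ i, σ₃ i, σ₄ i] := fun i =>
    perm_remove_four (R i) (σ₁ i) (σ₂ i) (σ₃ i) (σ₄ i) (hR i)
  -- indicator bookkeeping
  have hcnt : ∀ i j, (if R i = j then (1 : ℕ) else 0) + (if a i = j then 1 else 0) + (if b i = j then 1 else 0) +
      (if c i = j then 1 else 0) = (if σ₁ i = j then (1 : ℕ) else 0) + (if σ₂ i = j then 1 else 0) + (if σ₃ i = j then 1 else 0) +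
      (if σ₄ i = j then 1 else 0) := by
    intro i j
    have := ((hPabc i).map fun x => if x = j then (1 : ℕ) else 0).sum_eq
    simpa [add_assoc] using this
  have hcol : ∀ j, (∑ i, if a i = j then (1 : ℕ) else 0) + (∑ i, if b i = j then (1 : ℕ) else 0) +
      (∑ i, if c i = j then (1 : ℕ) else 0) = 3 := by
    intro j
    have hsum := Finset.sum_congr rfl fun i (_ : i ∈ (Finset.univ : Finset V)) => hcnt i j
    rw [Finset.sum_add_distrib, Finset.sum_add_distrib, Finset.sum_add_distrib, Finset.sum_add_distrib, Finset.sum_add_distrib,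
      Finset.sum_add_distrib, FourBit.sum_ite_apply_eq R j, FourBit.sum_ite_apply_eq σ₁ j, FourBit.sum_ite_apply_eq σ₂ j,
      FourBit.sum_ite_apply_eq σ₃ j, FourBit.sum_ite_apply_eq σ₄ j] at hsum
    omega
  obtain ⟨f, hfbij, hf⟩ := hall_three a b c hcol
  -- the two remaining targets after `f`
  let p : V → V := fun i => if f i = a i then b i else a i
  let q : V → V := fun i => if f i = a i then c i else if f i = b i then c i else b i
  have hPfpq : ∀ i, List.Perm [f i, p i, q i] [a i, b i, c i] := fun i => perm_remove_three (f i) (a i) (b i) (c i) (hf i)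
  have hcnt2 : ∀ i j, (if f i = j then (1 : ℕ) else 0) + (if p i = j then 1 else 0) + (if q i = j then 1 else 0)
      = (if a i = j then (1 : ℕ) else 0) + (if b i = j then 1 else 0) + (if c i = j then 1 else 0) := by
    intro i j
    have := ((hPfpq i).map fun x => if x = j then (1 : ℕ) else 0).sum_eq
    simpa [add_assoc] using this
  have hcol2 : ∀ j, (∑ i, if p i = j then (1 : ℕ) else 0) + (∑ i, if q i = j then (1 : ℕ) else 0) = 2 := by
    intro j
    have hsum := Finset.sum_congr rfl fun i (_ : i ∈ (Finset.univ : Finset V)) => hcnt2 i j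
    rw [Finset.sum_add_distrib, Finset.sum_add_distrib, Finset.sum_add_distrib, Finset.sum_add_distrib,
      sum_ite_eq_one_of_bijective hfbij j] at hsum
    have h3 := hcol j
    omega
  obtain ⟨g, h, hgbij, hhbij, hgh⟩ := split_two p q hcol2
  refine ⟨Equiv.ofBijective f hfbij, Equiv.ofBijective g hgbij, Equiv.ofBijective h hhbij, fun i => ?_⟩
  change List.Perm [R i, f i, g i, h i] [σ₁ i, σ₂ i, σ₃ i, σ₄ i]
  have h1 : List.Perm [f i, g i, h i] [a i, b i, c i] := by
    rcases hgh i with ⟨hg, hh⟩ | ⟨hg, hh⟩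
    · rw [hg, hh]; exact hPfpq i
    · rw [hg, hh]; exact (List.Perm.cons (f i) (List.Perm.swap (p i) (q i) [])).trans (hPfpq i)
  exact (List.Perm.cons (R i) h1).trans (hPabc i)

end Core
end MarkedEdge
end Summit.ValiantsHypothesis.ValiantsHypothesis.Theorems.KPlusLogSqLaw
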